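import Literature.Geometry.Riemannian.RicciFlowMaximalScaling
import Literature.Geometry.Riemannian.CurvatureNormSq
import HarnessLib

/-!
# The parabolically rescaled flows of the blow-up sequence
(stub `stub_rescaledFlow` of line `margerin-cone-hamilton-rails`, crux
`EntropyRung.ChangGurskyYang`, item stmt-SmoothPoincare4-10834)

Level-2 reduction of the blow-up limit at a finite singular time (input of Hamilton's compactness
theorem for flows, which wants flows on `[-A, 0]` with `|Rm| ≤ C` in frame form): given a Ricci
flow `(g, cov)` of Riemannian metrics on the closed 4-manifold `M` on `[0, T)`, a time
`t₀ ∈ [0, T)` and a scale `Q ≥ 1` with `|Rm|² ≤ Q²` on `M × [0, t₀]` (`curvNormSqWith`, the full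
contraction of Topping 2006, (3.2.4)), the **parabolic rescaling about `t₀`**
`s ↦ Q · g(t₀ + s/Q)`, `s ∈ [-Q t₀, 0]` (Hamilton 1995, §16; Topping 2006, §1.2.3, (1.2.7)),
with the same Levi-Civita connections `s ↦ cov (t₀ + s/Q)`,
1. is a Ricci flow on `[-Q t₀, 0]`: time translation by `t₀` (`IsRicciFlow.comp_add_const`),
   parabolic rescaling by `Q` (`IsRicciFlow.parabolicRescale`) and restriction
   (`IsRicciFlow.mono`) to `[-Q t₀, 0]`, whose points `s` correspond to original times
   `t₀ + s/Q ∈ [0, t₀] ⊆ [0, T)`;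
2. consists of Riemannian metrics (`IsRiemannian.constSmul`, `Q > 0`);
3. has curvature frame-bounded by `1`: `|Rm|² ≤ Q²` gives the frame bound `√(Q²) = Q` for
   `(g, cov)` (`curvatureBoundedBy_of_curvNormSqWith_le`, Topping 2006, p. 37), i.e. the frame
   bound `Q⁻¹ · Q = 1` for `Q · g` (`curvatureBoundedBy_constSmul_iff`: `|Rm|` scales like `λ⁻¹`
   under `g ↦ λ g`, Topping 2006, §1.2.3).
Everything is proved from tree theorems; no definition, no named fact.

References: R. S. Hamilton, *The formation of singularities in the Ricci flow*, Surveys in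
Differential Geometry II (1995) 7–136, §16 [Hamilton1995]; P. Topping, *Lectures on the Ricci
flow*, LMS LNS 325 (2006), §1.2.3, (1.2.7) and §3.2, p. 37 [Topping2006]; B.-L. Chen, X.-P. Zhu,
J. Differential Geom. 74 (2006) 177–264, §§3–4 [ChenZhu2006].
-/

noncomputable section

-- every `Summit.SmoothPoincare4.SmoothPoincare4.…` name repeats the summit = sub-problem segment (D-0017 layout)
set_option linter.dupNamespace false

open Set Function Filter
open scoped Manifold ContDiff Topology

namespace Summit.SmoothPoincare4.SmoothPoincare4.Theorems.MargerinRails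

open Literature.Geometry.Riemannian
open Literature.Geometry.Lorentzian Literature.Geometry.Lorentzian.PseudoRiemannianMetric

/-- **STUB — THE RESCALED FLOWS `s ↦ Q · g(t₀ + s/Q)` ON `[-Q t₀, 0]`** (Hamilton 1995, §16;
Topping 2006, §1.2.3, (1.2.7)). For a Ricci flow `(g, cov)` of Riemannian metrics on `[0, T)`, a
time `t₀ ∈ [0, T)` and a scale `Q ≥ 1` with `|Rm|² ≤ Q²` on `M × [0, t₀]`: the family
`s ↦ Q · g(t₀ + Q⁻¹ s)` with connections `s ↦ cov (t₀ + Q⁻¹ s)` is a Ricci flow on `[-Q t₀, 0]`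
(`IsRicciFlow.comp_add_const`, `IsRicciFlow.parabolicRescale`, `IsRicciFlow.mono`; the rescaled
time `s` is the original time `t₀ + Q⁻¹ s ∈ [0, t₀]`), of Riemannian metrics
(`IsRiemannian.constSmul`), with curvature frame-bounded by `1`
(`curvatureBoundedBy_of_curvNormSqWith_le` gives the frame bound `√(Q²) = Q` before rescaling,
`curvatureBoundedBy_constSmul_iff` divides it by `Q`).
[cite: Topping2006, §1.2.3, (1.2.7)] [cite: Hamilton1995, §16] -/
theorem stub_rescaledFlow :
    ∀ (M : Type) [TopologicalSpace M] [T2Space M] [SecondCountableTopology M]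
      [ChartedSpace (EuclideanSpace ℝ (Fin 4)) M] [IsManifold (𝓡 4) ∞ M] [CompactSpace M]
      (g : ℝ → PseudoRiemannianMetric (𝓡 4) ∞ (EuclideanSpace ℝ (Fin 4)) (TangentSpace (𝓡 4) : M → Type _))
      (cov : ℝ → CovariantDerivative (𝓡 4) (EuclideanSpace ℝ (Fin 4)) (TangentSpace (𝓡 4) : M → Type _))
      (T : ℝ), IsRicciFlow g cov (Ico 0 T) → (∀ t ∈ Ico 0 T, (g t).IsRiemannian) →
      ∀ (t₀ Q : ℝ) (hQ : 1 ≤ Q), t₀ ∈ Ico 0 T →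
      (∀ s ∈ Icc 0 t₀, ∀ x : M, (g s).curvNormSqWith (cov s) x ≤ Q ^ 2) →
      IsRicciFlow (fun s ↦ (g (t₀ + Q⁻¹ * s)).constSmul Q (one_pos.trans_le hQ).ne')
          (fun s ↦ cov (t₀ + Q⁻¹ * s)) (Icc (-(Q * t₀)) 0) ∧
        (∀ s ∈ Icc (-(Q * t₀)) 0,
          ((g (t₀ + Q⁻¹ * s)).constSmul Q (one_pos.trans_le hQ).ne').IsRiemannian) ∧
        (∀ s ∈ Icc (-(Q * t₀)) 0,
          CurvatureBoundedBy ((g (t₀ + Q⁻¹ * s)).constSmul Q (one_pos.trans_le hQ).ne')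
            (cov (t₀ + Q⁻¹ * s)) 1) := by
  intro M _ _ _ _ _ _ g cov T hflow hR t₀ Q hQ ht₀ hbound
  have hQpos : 0 < Q := one_pos.trans_le hQ
  -- the rescaled time `s ∈ [-Q t₀, 0]` is the original time `t₀ + s/Q ∈ [0, t₀] ⊆ [0, T)`
  have htime : ∀ s ∈ Icc (-(Q * t₀)) 0, t₀ + Q⁻¹ * s ∈ Icc 0 t₀ := by
    intro s hs
    have hQs : Q * (Q⁻¹ * s) = s := by rw [← mul_assoc, mul_inv_cancel₀ hQpos.ne', one_mul]
    have h₁ : -t₀ ≤ Q⁻¹ * s := le_of_mul_le_mul_left (by rw [hQs, mul_neg]; exact hs.1) hQpos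
    have h₂ : Q⁻¹ * s ≤ 0 := mul_nonpos_iff.2 (Or.inl ⟨inv_nonneg.2 hQpos.le, hs.2⟩)
    constructor <;> linarith
  have hsub : ∀ s ∈ Icc (-(Q * t₀)) 0, t₀ + Q⁻¹ * s ∈ Ico 0 T := fun s hs ↦
    ⟨(htime s hs).1, (htime s hs).2.trans_lt ht₀.2⟩
  refine ⟨?_, fun s hs ↦ (hR _ (hsub s hs)).constSmul hQpos, fun s hs ↦ ?_⟩
  · -- time translation by `t₀`, parabolic rescaling by `Q`, restriction to `[-Q t₀, 0]`
    have h₁ := (hflow.comp_add_const t₀).parabolicRescale hQpos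
    have hg : (fun s ↦ (g (t₀ + Q⁻¹ * s)).constSmul Q (one_pos.trans_le hQ).ne') =
        fun s ↦ (g (Q⁻¹ * s + t₀)).constSmul Q hQpos.ne' := by
      funext s
      rw [add_comm]
    have hc : (fun s ↦ cov (t₀ + Q⁻¹ * s)) = fun s ↦ cov (Q⁻¹ * s + t₀) := by
      funext s
      rw [add_comm]
    rw [hg, hc]
    refine h₁.mono fun s hs ↦ ?_
    show Q⁻¹ * s + t₀ ∈ Ico 0 T
    rw [add_comm]
    exact hsub s hs
  · -- `|Rm|² ≤ Q²` ⇒ frame bound `√(Q²) = Q = Q · 1` for `g`, i.e. frame bound `1` for `Q · g`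
    have hs' := hsub s hs
    have hb := curvatureBoundedBy_of_curvNormSqWith_le (hR _ hs') (hflow.isLeviCivita _ hs')
      fun x ↦ hbound _ (htime s hs) x
    rw [Real.sqrt_sq hQpos.le] at hb
    exact (curvatureBoundedBy_constSmul_iff _ _ hQpos 1).2 (by rwa [mul_one])

end Summit.SmoothPoincare4.SmoothPoincare4.Theorems.MargerinRails

end
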